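import Mathlib
import HarnessLib
import Literature.Analysis.FluidPDE.SuitableWeak
import Literature.Analysis.FluidPDE.SelfSimilar
import Literature.Analysis.FluidPDE.ParasiticSlabFlow
import Summits.NavierStokesRegularity.NavierStokesRegularity.Theorems.StableStrataDoorOneSliceDefs

/-!
# StableStrataDoorFloorSurvives — SEED-26 input **I2a `FloorSurvives` PROVED** (door S26 «StableStrataDoor», sequential
ε-door; nsreg-p1 g21 ADDENDUM-25A; text = `StableStrataDoorOneSliceDefs.FloorSurvives` VERBATIM)

`floorSurvives_holds (hc : 0 < c) : FloorSurvives D c` for EVERY decay constant `D`: a sequence of jointly continuous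
fields `uₙ` on `(−∞,0) × ℝ³` with the uniform Type-I decay `‖uₙ(t,x)‖ ≤ D/(‖x‖+√−t)` and Seregin's scale-invariant
`L³`-floor `c·r² ≤ ∫_{Q(r)} ‖uₙ‖³` (all `r > 0`) cannot converge pointwise to `0` on `t < −1/4`.

PROOF (pure measure theory, no Navier–Stokes).  Fix `R = 3|B₁|D³/c + 1` and split the parabolic cylinder
`Q(R) = (−R², 0) × B_R ⊆ [(−R², −1/4) × B_R] ∪ [[−1/4, 0) × B_R]`.
* FAR PART `(−R², −1/4) × B_R`: there `‖uₙ‖ ≤ 2D`, the set has finite measure and `uₙ → 0` pointwise, so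
  `∫ ‖uₙ‖³ → 0` (dominated convergence, `tendsto_lintegral_far`).
* NEAR SLAB `[−1/4, 0) × B_R`: `(‖y‖+√−s)³ ≥ ‖y‖²·√−s` gives the product majorant `D³ ‖y‖⁻² (√−s)⁻¹` (off the null
  axis `y = 0`); by Tonelli, the polar-coordinates identity `∫_{B_R} ‖y‖⁻² dy = 3|B₁|R` (`integral_fun_norm_addHaar`:
  the radial weight `r²` cancels the singularity) and `∫_{−1/4}^{0} (√−s)⁻¹ ds = 1`, the slab carries at most
  `3|B₁|D³R`, uniformly in `n` (`lintegral_near_le`).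
Hence `cR² ≤ o(1) + 3|B₁|D³R`, i.e. `cR ≤ 3|B₁|D³ = cR − c` in the limit — absurd.

Door family of LADDER-NS N0 (door S26 / SEED-26; `--supports stmt-NavierStokesRegularity-0056`, helper lane; nsreg-p6 g14).
WHAT THIS IS NOT: not NS regularity (Clay A); no route, no item; I2a is one of three typed inputs (I1, I2a, I2b) of the
SEQUENTIAL ε-axisymmetric door T-axi-seq, itself a criterion INSIDE the Type-I class.
-/

noncomputable section

set_option linter.dupNamespace false

namespace Summit.NavierStokesRegularity.NavierStokesRegularity.Theorems.StableStrataDoorFloorSurvives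

open MeasureTheory Set Function Filter Topology TopologicalSpace Metric
open scoped RealInnerProductSpace NNReal ENNReal Topology
open Literature.Analysis Literature.Analysis.FluidPDE
open Summit.NavierStokesRegularity.NavierStokesRegularity.Theorems.StableStrataDoorOneSliceDefs

/-! ## Pointwise consequences of the Type-I decay -/

/-- Far from the apex in time (`s ≤ −1/4`) a Type-I(`D`) field is bounded by `2D`, so `‖v‖³ ≤ 8D³`. -/
theorem norm_cube_le_far {D : ℝ} {v : ℝ → EuclideanSpace ℝ (Fin 3) → EuclideanSpace ℝ (Fin 3)}
    (hdec : HasTypeIDecay D v) {s : ℝ} (hs : s ≤ -(1 / 4 : ℝ)) (y : EuclideanSpace ℝ (Fin 3)) :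
    ‖v s y‖ ^ 3 ≤ 8 * D ^ 3 := by
  have hD : 0 ≤ D := nonneg_of_hasTypeIDecay hdec
  have hs0 : s < 0 := by linarith
  have hsq : (1 / 2 : ℝ) ≤ Real.sqrt (-s) := by
    rw [show (1 / 2 : ℝ) = Real.sqrt (1 / 4) by
      rw [show (1 / 4 : ℝ) = (1 / 2) ^ 2 by norm_num, Real.sqrt_sq (by norm_num)]]
    exact Real.sqrt_le_sqrt (by linarith)
  have hden : (1 / 2 : ℝ) ≤ ‖y‖ + Real.sqrt (-s) := by linarith [norm_nonneg y]
  have h1 : ‖v s y‖ ≤ 2 * D := by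
    calc ‖v s y‖ ≤ D / (‖y‖ + Real.sqrt (-s)) := hdec s hs0 y
      _ ≤ D / (1 / 2) := div_le_div_of_nonneg_left hD (by norm_num) hden
      _ = 2 * D := by ring
  calc ‖v s y‖ ^ 3 ≤ (2 * D) ^ 3 := by gcongr
    _ = 8 * D ^ 3 := by ring

/-- Near the apex, off the axis `y = 0`: `‖v(s,y)‖³ ≤ D³ · (‖y‖²)⁻¹ · (√−s)⁻¹`, from `(a+b)³ ≥ a² b`. -/
theorem norm_cube_le_near {D : ℝ} {v : ℝ → EuclideanSpace ℝ (Fin 3) → EuclideanSpace ℝ (Fin 3)}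
    (hdec : HasTypeIDecay D v) {s : ℝ} (hs : s < 0) {y : EuclideanSpace ℝ (Fin 3)} (hy : y ≠ 0) :
    ‖v s y‖ ^ 3 ≤ D ^ 3 * (‖y‖ ^ 2)⁻¹ * (Real.sqrt (-s))⁻¹ := by
  have hD : 0 ≤ D := nonneg_of_hasTypeIDecay hdec
  have ha : 0 < ‖y‖ := norm_pos_iff.2 hy
  have hb : 0 < Real.sqrt (-s) := Real.sqrt_pos.2 (by linarith)
  have hab : 0 < ‖y‖ + Real.sqrt (-s) := by positivity
  have h1 : ‖v s y‖ ^ 3 ≤ D ^ 3 / (‖y‖ + Real.sqrt (-s)) ^ 3 := by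
    rw [← div_pow]
    gcongr
    exact hdec s hs y
  have h2 : ‖y‖ ^ 2 * Real.sqrt (-s) ≤ (‖y‖ + Real.sqrt (-s)) ^ 3 := by
    nlinarith [mul_pos ha hb, mul_pos (mul_pos ha ha) hb, mul_pos (mul_pos hb hb) ha, pow_pos hb 3, pow_pos ha 3]
  calc ‖v s y‖ ^ 3 ≤ D ^ 3 / (‖y‖ + Real.sqrt (-s)) ^ 3 := h1
    _ ≤ D ^ 3 / (‖y‖ ^ 2 * Real.sqrt (-s)) :=
        div_le_div_of_nonneg_left (by positivity) (by positivity) h2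
    _ = D ^ 3 * (‖y‖ ^ 2)⁻¹ * (Real.sqrt (-s))⁻¹ := by
        rw [div_eq_mul_inv, mul_inv, mul_assoc]

/-! ## The two one-dimensional / radial integrals -/

/-- `∫_{B_R} ‖y‖⁻² dy = 3 |B₁| R` in `ℝ³` (polar coordinates: the radial weight `r²` cancels the singularity). -/
theorem integral_inv_norm_sq_ball {R : ℝ} (hR : 0 < R) :
    ∫ y in ball (0 : EuclideanSpace ℝ (Fin 3)) R, (‖y‖ ^ 2)⁻¹ =
      3 * volume.real (ball (0 : EuclideanSpace ℝ (Fin 3)) 1) * R := by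
  have hind : (fun y : EuclideanSpace ℝ (Fin 3) => (ball (0 : EuclideanSpace ℝ (Fin 3)) R).indicator
      (fun y => (‖y‖ ^ 2)⁻¹) y) = fun y => ((Iio R).indicator (fun r : ℝ => (r ^ 2)⁻¹)) ‖y‖ := by
    funext y
    by_cases h : ‖y‖ < R
    · rw [indicator_of_mem (mem_ball_zero_iff.2 h), indicator_of_mem (mem_Iio.2 h)]
    · rw [indicator_of_notMem (fun h' => h (mem_ball_zero_iff.1 h')), indicator_of_notMem (show ‖y‖ ∉ Iio R from h)]
  rw [← integral_indicator measurableSet_ball, hind,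
    integral_fun_norm_addHaar volume ((Iio R).indicator (fun r : ℝ => (r ^ 2)⁻¹)),
    finrank_euclideanSpace_fin]
  have hI : ∫ y in Ioi (0 : ℝ), y ^ (3 - 1) • (Iio R).indicator (fun r : ℝ => (r ^ 2)⁻¹) y = R := by
    have heq : EqOn (fun y : ℝ => y ^ (3 - 1) • (Iio R).indicator (fun r : ℝ => (r ^ 2)⁻¹) y)
        ((Iio R).indicator fun _ => (1 : ℝ)) (Ioi (0 : ℝ)) := by
      intro y hy
      have hy0 : (y : ℝ) ≠ 0 := ne_of_gt hy
      by_cases h : y < R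
      · simp only [indicator_of_mem (mem_Iio.2 h), smul_eq_mul]
        field_simp
      · simp only [indicator_of_notMem (show y ∉ Iio R from h), smul_zero]
    rw [setIntegral_congr_fun measurableSet_Ioi heq, setIntegral_indicator measurableSet_Iio,
      setIntegral_const, Ioi_inter_Iio, Real.volume_real_Ioo_of_le hR.le, smul_eq_mul, sub_zero, mul_one]
  rw [hI, nsmul_eq_mul, smul_eq_mul]
  push_cast
  ring

/-- `y ↦ K · ‖y‖⁻²` is integrable on every ball of `ℝ³` (exponent `2 < 3`; the form consumed by the slab bound). -/
theorem integrableOn_const_mul_inv_norm_sq_ball (K R : ℝ) :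
    IntegrableOn (fun y : EuclideanSpace ℝ (Fin 3) => K * (‖y‖ ^ 2)⁻¹) (ball (0 : EuclideanSpace ℝ (Fin 3)) R) volume := by
  refine integrableOn_ball_of_norm_le_rpow (μ := volume) (C := |K|) (α := 2) ?_ ?_ ?_ ?_
  · rw [finrank_euclideanSpace_fin]; norm_num
  · rw [finrank_euclideanSpace_fin]; norm_num
  · refine Eventually.of_forall fun y => ?_
    rw [norm_mul, Real.norm_eq_abs, Real.norm_eq_abs, abs_of_nonneg (by positivity : (0 : ℝ) ≤ (‖y‖ ^ 2)⁻¹),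
      Real.rpow_neg (norm_nonneg _), Real.rpow_two]
  · exact (measurable_const.mul ((continuous_norm.pow 2).measurable.inv)).aestronglyMeasurable

/-- `∫_{−1/4}^{0} (√−s)⁻¹ ds = 1`. -/
theorem integral_inv_sqrt_neg_Ico :
    ∫ s in Ico (-(1 / 4 : ℝ)) 0, (Real.sqrt (-s))⁻¹ = 1 := by
  rw [integral_Ico_eq_integral_Ioo, ← integral_Ioc_eq_integral_Ioo,
    ← intervalIntegral.integral_of_le (by norm_num : (-(1 / 4 : ℝ)) ≤ 0),
    intervalIntegral.integral_comp_neg (fun x : ℝ => (Real.sqrt x)⁻¹), neg_zero, neg_neg]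
  have heq : EqOn (fun x : ℝ => (Real.sqrt x)⁻¹) (fun x => x ^ (-(1 / 2 : ℝ))) (uIcc (0 : ℝ) (1 / 4)) := by
    intro x hx
    rw [uIcc_of_le (by norm_num : (0 : ℝ) ≤ 1 / 4)] at hx
    simp only
    rw [Real.sqrt_eq_rpow, Real.rpow_neg hx.1]
  rw [intervalIntegral.integral_congr heq, integral_rpow (Or.inl (by norm_num))]
  rw [show (-(1 / 2 : ℝ)) + 1 = 1 / 2 by norm_num, Real.zero_rpow (by norm_num),
    ← Real.sqrt_eq_rpow, show (1 / 4 : ℝ) = (1 / 2) ^ 2 by norm_num, Real.sqrt_sq (by norm_num)]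
  norm_num

/-- `s ↦ (√−s)⁻¹` is integrable on `[−1/4, 0)`. -/
theorem integrableOn_inv_sqrt_neg_Ico :
    IntegrableOn (fun s : ℝ => (Real.sqrt (-s))⁻¹) (Ico (-(1 / 4 : ℝ)) 0) volume := by
  have h1 : IntervalIntegrable (fun x : ℝ => x ^ (-(1 / 2 : ℝ))) volume 0 (1 / 4) :=
    intervalIntegral.intervalIntegrable_rpow' (by norm_num)
  have h2 := h1.comp_sub_left 0
  simp only [zero_sub, sub_zero] at h2
  -- `h2 : IntervalIntegrable (fun x => (-x) ^ (-(1/2))) volume 0 (-(1/4))`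
  have h3 : IntegrableOn (fun x : ℝ => (-x) ^ (-(1 / 2 : ℝ))) (Ioc (-(1 / 4 : ℝ)) 0) volume := h2.2
  have h4 : IntegrableOn (fun x : ℝ => (-x) ^ (-(1 / 2 : ℝ))) (Ico (-(1 / 4 : ℝ)) 0) volume := by
    rw [integrableOn_Ico_iff_integrableOn_Ioo, ← integrableOn_Ioc_iff_integrableOn_Ioo]
    exact h3
  refine h4.congr_fun (fun s hs => ?_) measurableSet_Ico
  simp only
  rw [Real.sqrt_eq_rpow, Real.rpow_neg (by linarith [hs.2])]


/-! ## The near-apex slab `[−1/4, 0) × B_R`: a bound LINEAR in `R` -/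

/-- On the slab `[−1/4, 0) × B_R` the cube of a Type-I(`D`) field integrates to at most `3|B₁|·D³·R`
(Tonelli on the product majorant `D³ ‖y‖⁻² (√−s)⁻¹`, the radial integral `3|B₁|R` and the time integral `1`). -/
theorem lintegral_near_le {D : ℝ} {v : ℝ → EuclideanSpace ℝ (Fin 3) → EuclideanSpace ℝ (Fin 3)}
    (hdec : HasTypeIDecay D v) {R : ℝ} (hR : 0 < R) :
    ∫⁻ z in Ico (-(1 / 4 : ℝ)) 0 ×ˢ ball (0 : EuclideanSpace ℝ (Fin 3)) R, ENNReal.ofReal (‖uncurry v z‖ ^ 3) ≤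
      ENNReal.ofReal (3 * volume.real (ball (0 : EuclideanSpace ℝ (Fin 3)) 1) * D ^ 3 * R) := by
  have hD : 0 ≤ D := nonneg_of_hasTypeIDecay hdec
  set G : EuclideanSpace ℝ (Fin 3) → ℝ≥0∞ := fun y => ENNReal.ofReal (D ^ 3 * (‖y‖ ^ 2)⁻¹) with hG
  set H : ℝ → ℝ≥0∞ := fun s => ENNReal.ofReal ((Real.sqrt (-s))⁻¹) with hH
  have hSm : MeasurableSet (Ico (-(1 / 4 : ℝ)) 0 ×ˢ ball (0 : EuclideanSpace ℝ (Fin 3)) R) :=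
    measurableSet_Ico.prod measurableSet_ball
  -- almost every space–time point is off the axis `y = 0`
  have hax : ∀ᵐ z : ℝ × EuclideanSpace ℝ (Fin 3) ∂volume, z.2 ≠ 0 := by
    have h0 : volume {z : ℝ × EuclideanSpace ℝ (Fin 3) | z.2 = 0} = 0 := by
      have : {z : ℝ × EuclideanSpace ℝ (Fin 3) | z.2 = 0} =
          (univ : Set ℝ) ×ˢ ({0} : Set (EuclideanSpace ℝ (Fin 3))) := by
        ext z; simp
      rw [this, Measure.volume_eq_prod, Measure.prod_prod, measure_singleton, mul_zero]
    filter_upwards [measure_eq_zero_iff_ae_notMem.1 h0] with z hz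
    simpa using hz
  -- pointwise domination, a.e. on the slab
  have hdom : ∀ᵐ z ∂volume.restrict (Ico (-(1 / 4 : ℝ)) 0 ×ˢ ball (0 : EuclideanSpace ℝ (Fin 3)) R),
      ENNReal.ofReal (‖uncurry v z‖ ^ 3) ≤ H z.1 * G z.2 := by
    rw [ae_restrict_iff' hSm]
    filter_upwards [hax] with z hz hmem
    rw [mem_prod, mem_Ico] at hmem
    have hs : z.1 < 0 := hmem.1.2
    simp only [hG, hH, uncurry]
    rw [← ENNReal.ofReal_mul (inv_nonneg.2 (Real.sqrt_nonneg _))]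
    refine ENNReal.ofReal_le_ofReal ?_
    calc ‖v z.1 z.2‖ ^ 3 ≤ D ^ 3 * (‖z.2‖ ^ 2)⁻¹ * (Real.sqrt (-z.1))⁻¹ := norm_cube_le_near hdec hs hz
      _ = (Real.sqrt (-z.1))⁻¹ * (D ^ 3 * (‖z.2‖ ^ 2)⁻¹) := by ring
  -- Tonelli for the product majorant
  have hHm : Measurable H := by
    rw [hH]
    exact ((Real.continuous_sqrt.comp continuous_neg).measurable.inv).ennreal_ofReal
  have hGm : Measurable G := by
    rw [hG]
    exact (measurable_const.mul ((continuous_norm.pow 2).measurable.inv)).ennreal_ofReal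
  have hprod : ∫⁻ z in Ico (-(1 / 4 : ℝ)) 0 ×ˢ ball (0 : EuclideanSpace ℝ (Fin 3)) R, H z.1 * G z.2 =
      (∫⁻ s in Ico (-(1 / 4 : ℝ)) 0, H s) * ∫⁻ y in ball (0 : EuclideanSpace ℝ (Fin 3)) R, G y := by
    rw [Measure.volume_eq_prod, ← Measure.prod_restrict, lintegral_prod_mul hHm.aemeasurable hGm.aemeasurable]
  -- the two factors
  have hHint : ∫⁻ s in Ico (-(1 / 4 : ℝ)) 0, H s = 1 := by
    rw [hH, ← ofReal_integral_eq_lintegral_ofReal integrableOn_inv_sqrt_neg_Ico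
      (ae_of_all _ (fun s => inv_nonneg.2 (Real.sqrt_nonneg _))), integral_inv_sqrt_neg_Ico, ENNReal.ofReal_one]
  have hGint : ∫⁻ y in ball (0 : EuclideanSpace ℝ (Fin 3)) R, G y =
      ENNReal.ofReal (D ^ 3 * (3 * volume.real (ball (0 : EuclideanSpace ℝ (Fin 3)) 1) * R)) := by
    rw [hG, ← ofReal_integral_eq_lintegral_ofReal (integrableOn_const_mul_inv_norm_sq_ball (D ^ 3) R)
      (ae_of_all _ (fun y => by positivity)), integral_const_mul (D ^ 3), integral_inv_norm_sq_ball hR]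
  calc ∫⁻ z in Ico (-(1 / 4 : ℝ)) 0 ×ˢ ball (0 : EuclideanSpace ℝ (Fin 3)) R, ENNReal.ofReal (‖uncurry v z‖ ^ 3)
      ≤ ∫⁻ z in Ico (-(1 / 4 : ℝ)) 0 ×ˢ ball (0 : EuclideanSpace ℝ (Fin 3)) R, H z.1 * G z.2 :=
        lintegral_mono_ae hdom
    _ = 1 * ENNReal.ofReal (D ^ 3 * (3 * volume.real (ball (0 : EuclideanSpace ℝ (Fin 3)) 1) * R)) := by
        rw [hprod, hHint, hGint]
    _ = ENNReal.ofReal (3 * volume.real (ball (0 : EuclideanSpace ℝ (Fin 3)) 1) * D ^ 3 * R) := by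
        rw [one_mul]; congr 1; ring

/-! ## The far region `(−R², −1/4) × B_R`: bounded convergence -/

/-- On `(−R², −1/4) × B_R`, where the fields are uniformly bounded by `2D` and converge pointwise to `0`, the
integrals of the cubes tend to `0` (dominated convergence on a set of finite measure). -/
theorem tendsto_lintegral_far {D : ℝ} {u : ℕ → ℝ → EuclideanSpace ℝ (Fin 3) → EuclideanSpace ℝ (Fin 3)}
    (hcont : ∀ n, ContinuousOn (uncurry (u n)) (Iio (0 : ℝ) ×ˢ univ)) (hdec : ∀ n, HasTypeIDecay D (u n))
    (hlim : ∀ s < -(1 / 4 : ℝ), ∀ y, Tendsto (fun n => u n s y) atTop (𝓝 0)) (R : ℝ) :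
    Tendsto (fun n => ∫⁻ z in Ioo (-R ^ 2) (-(1 / 4 : ℝ)) ×ˢ ball (0 : EuclideanSpace ℝ (Fin 3)) R,
      ENNReal.ofReal (‖uncurry (u n) z‖ ^ 3)) atTop (𝓝 0) := by
  set S : Set (ℝ × EuclideanSpace ℝ (Fin 3)) := Ioo (-R ^ 2) (-(1 / 4 : ℝ)) ×ˢ ball (0 : EuclideanSpace ℝ (Fin 3)) R
    with hS
  have hSm : MeasurableSet S := measurableSet_Ioo.prod measurableSet_ball
  have hSsub : S ⊆ Iio (0 : ℝ) ×ˢ univ := by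
    intro z hz
    refine ⟨?_, mem_univ _⟩
    have h := hz.1.2
    show z.1 < 0
    linarith
  have hSfin : volume S ≠ ⊤ := by
    rw [hS, Measure.volume_eq_prod, Measure.prod_prod, Real.volume_Ioo]
    exact ENNReal.mul_ne_top ENNReal.ofReal_ne_top measure_ball_lt_top.ne
  have hmeas : ∀ n, AEMeasurable (fun z => ENNReal.ofReal (‖uncurry (u n) z‖ ^ 3)) (volume.restrict S) := by
    intro n
    have h1 : AEStronglyMeasurable (uncurry (u n)) (volume.restrict S) :=
      ((hcont n).mono hSsub).aestronglyMeasurable hSm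
    exact (h1.norm.aemeasurable.pow_const 3).ennreal_ofReal
  have hbound : ∀ n, ∀ᵐ z ∂volume.restrict S,
      ENNReal.ofReal (‖uncurry (u n) z‖ ^ 3) ≤ ENNReal.ofReal (8 * D ^ 3) := by
    intro n
    refine ae_restrict_of_forall_mem hSm (fun z hz => ?_)
    exact ENNReal.ofReal_le_ofReal (norm_cube_le_far (hdec n) (le_of_lt hz.1.2) z.2)
  have hfin : ∫⁻ _ in S, ENNReal.ofReal (8 * D ^ 3) ∂volume ≠ ⊤ := by
    rw [setLIntegral_const]
    exact ENNReal.mul_ne_top ENNReal.ofReal_ne_top hSfin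
  have hptw : ∀ᵐ z ∂volume.restrict S,
      Tendsto (fun n => ENNReal.ofReal (‖uncurry (u n) z‖ ^ 3)) atTop (𝓝 ((fun _ => (0 : ℝ≥0∞)) z)) := by
    refine ae_restrict_of_forall_mem hSm (fun z hz => ?_)
    have h1 : Tendsto (fun n => u n z.1 z.2) atTop (𝓝 0) := hlim z.1 hz.1.2 z.2
    have h2 : Tendsto (fun n => ‖u n z.1 z.2‖ ^ 3) atTop (𝓝 0) := by
      have h := ((continuous_norm.tendsto _).comp h1).pow 3
      rw [norm_zero] at h
      simpa using h
    have h3 := (ENNReal.continuous_ofReal.tendsto 0).comp h2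
    rw [ENNReal.ofReal_zero] at h3
    exact h3
  have h := tendsto_lintegral_of_dominated_convergence' (μ := volume.restrict S)
    (fun _ => ENNReal.ofReal (8 * D ^ 3)) hmeas hbound hfin hptw
  simpa using h

/-! ## I2a PROVED -/

/-- **I2a · THE FLOOR SURVIVES** (pure analysis), for every floor constant `c > 0` and every decay constant `D`:
a sequence of jointly continuous fields on `(−∞,0) × ℝ³` with the uniform Type-I decay `D/(|x|+√−t)` and the
scale-invariant `L³`-floor `c·r² ≤ ∫_{Q(r)} |uₙ|³` (all `r > 0`) cannot converge pointwise to `0` on `t < −1/4`.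
Proof: at radius `R = 3|B₁|D³/c + 1` the floor gives `cR² ≤ ∫_{Q(R)} |uₙ|³ ≤ (far part → 0 by bounded
convergence on `(−R², −1/4) × B_R`) + (near slab `[−1/4,0) × B_R` ≤ `3|B₁|D³R` uniformly in `n`), so in the limit
`cR ≤ 3|B₁|D³ = cR − c`, absurd. -/
theorem floorSurvives_holds {D c : ℝ} (hc : 0 < c) : FloorSurvives D c := by
  intro u hcont hdec hfloor hlim
  have hD : 0 ≤ D := nonneg_of_hasTypeIDecay (hdec 0)
  set VB : ℝ := volume.real (ball (0 : EuclideanSpace ℝ (Fin 3)) 1) with hVB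
  have hVB0 : 0 ≤ VB := measureReal_nonneg
  set A : ℝ := 3 * VB * D ^ 3 with hA
  have hA0 : 0 ≤ A := by positivity
  set R : ℝ := A / c + 1 with hR
  have hR1 : 1 ≤ R := by
    have : 0 ≤ A / c := div_nonneg hA0 hc.le
    linarith
  have hR0 : 0 < R := by linarith
  set Sfar : Set (ℝ × EuclideanSpace ℝ (Fin 3)) := Ioo (-R ^ 2) (-(1 / 4 : ℝ)) ×ˢ ball (0 : EuclideanSpace ℝ (Fin 3)) R
    with hSfar
  set Snear : Set (ℝ × EuclideanSpace ℝ (Fin 3)) := Ico (-(1 / 4 : ℝ)) 0 ×ˢ ball (0 : EuclideanSpace ℝ (Fin 3)) R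
    with hSnear
  have hQ : parabolicCylinder R (0 : ℝ × EuclideanSpace ℝ (Fin 3)) ⊆ Sfar ∪ Snear := by
    intro z hz
    rw [mem_parabolicCylinder] at hz
    have hb : z.2 ∈ ball (0 : EuclideanSpace ℝ (Fin 3)) R := by
      rw [mem_ball]
      simpa using hz.2
    have hlow : -R ^ 2 < z.1 := by simpa using hz.1.1
    have hup : z.1 < 0 := by simpa using hz.1.2
    rcases lt_or_ge z.1 (-(1 / 4 : ℝ)) with h | h
    · exact Or.inl ⟨⟨hlow, h⟩, hb⟩
    · exact Or.inr ⟨⟨h, hup⟩, hb⟩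
  set F : ℕ → ℝ × EuclideanSpace ℝ (Fin 3) → ℝ≥0∞ := fun n z => ENNReal.ofReal (‖uncurry (u n) z‖ ^ 3) with hF
  have hstep : ∀ n, ENNReal.ofReal (c * R ^ 2) ≤ (∫⁻ z in Sfar, F n z) + ENNReal.ofReal (A * R) := by
    intro n
    calc ENNReal.ofReal (c * R ^ 2)
        ≤ ∫⁻ z in parabolicCylinder R (0 : ℝ × EuclideanSpace ℝ (Fin 3)), F n z := hfloor n R hR0
      _ ≤ ∫⁻ z in Sfar ∪ Snear, F n z := lintegral_mono_set hQ
      _ ≤ (∫⁻ z in Sfar, F n z) + ∫⁻ z in Snear, F n z := lintegral_union_le _ _ _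
      _ ≤ (∫⁻ z in Sfar, F n z) + ENNReal.ofReal (A * R) := by
          gcongr
          calc ∫⁻ z in Snear, F n z ≤ ENNReal.ofReal (3 * VB * D ^ 3 * R) := lintegral_near_le (hdec n) hR0
            _ = ENNReal.ofReal (A * R) := by rw [hA]
  have hfar : Tendsto (fun n => ∫⁻ z in Sfar, F n z) atTop (𝓝 0) := tendsto_lintegral_far hcont hdec hlim R
  have hlimit : Tendsto (fun n => (∫⁻ z in Sfar, F n z) + ENNReal.ofReal (A * R)) atTop
      (𝓝 (0 + ENNReal.ofReal (A * R))) := hfar.add tendsto_const_nhds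
  have hle : ENNReal.ofReal (c * R ^ 2) ≤ 0 + ENNReal.ofReal (A * R) := ge_of_tendsto' hlimit hstep
  rw [zero_add, ENNReal.ofReal_le_ofReal_iff (by positivity)] at hle
  have h1 : c * R ≤ A := by
    have h' : (c * R) * R ≤ A * R := by nlinarith [hle]
    exact le_of_mul_le_mul_right h' hR0
  have h2 : c * R = A + c := by
    rw [hR]; field_simp
  linarith

end Summit.NavierStokesRegularity.NavierStokesRegularity.Theorems.StableStrataDoorFloorSurvives
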